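import Summits.Schanuel.Schanuel.Theorems.ZilberEacTwoScaleElimination
import HarnessLib

/-!
# THEOREM I‴: two coordinates decaying on SEPARATED scales and one polynomial coordinate
# support no polynomial relation

Zilber's Exponential-Algebraic Closedness, case ladder (host summit Schanuel, cell `pub-schanuel`,
seat 2, gen 15; the elimination engine for the DOUBLE-CANCELLING regime over NONLINEAR bases,
HANDOFF O60 (a)).  Companion of THEOREM I″ (`eventually_eval_ne_zero_of_twoScale`): there the two
fast coordinates lived on ONE scale `T` with `ℕ²`-independent rates; here they live on two
SEPARATED scales `T₀ ≫ T₁ → ∞` (`log|y₀| ≤ −T₀`, `log|y₁| = −T₁(1 + o(1))`, `T₁ = o(T₀)`), and the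
third coordinate tends to infinity with `log|y₂| = o(T₁)`.  Then NO nonzero `H ∈ ℂ[y₀, y₁, y₂]`
vanishes at the points eventually: order the support lexicographically — least power of `y₀`,
then least power of `y₁`, then the univariate polynomial `G(y₂)` carried by that class; the class
dominates every other monomial by a factor `e^{T₁/2}` (monomials with more `y₀` lose a factor
`e^{−T₀} ≪ e^{−(2B+1)T₁}`, monomials with the same `y₀`-power and more `y₁` lose `e^{−T₁/2}` — the
common power of `y₀` is factored out EXACTLY, so no rate for `y₀` is needed), and `|G(y₂)| ≥ c > 0`.

* **`eventually_eval_ne_zero_of_lexScale`** — THEOREM I‴.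
* **`unprojectedDense_of_lexScale`** — density form over `unprojectedDense_of_no_relation`.

HONEST FRAMING: an elimination lemma (no existence statement); it serves explicit families inside
the OPEN cell `ECCell 3 2`; NOT Schanuel's conjecture; EAC ⇏ SC.
-/

noncomputable section

open MvPolynomial Filter Topology
open Literature.NumberTheory.Transcendental Literature.ModelTheory.Zilber

set_option linter.dupNamespace false

namespace Summit.Schanuel.Schanuel.Theorems

section LexScale

/-- **THEOREM I‴ (two separated decay scales, one polynomial coordinate).**  See the module
docstring. (new) -/
theorem eventually_eval_ne_zero_of_lexScale (H : MvPolynomial (Fin 3) ℂ) (hH : H ≠ 0)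
    {y : ℕ → Fin 3 → ℂ} {T₀ T₁ : ℕ → ℝ} (hT₁ : Tendsto T₁ atTop atTop)
    (hT : ∀ ε : ℝ, 0 < ε → ∀ᶠ m in atTop, T₁ m ≤ ε * T₀ m)
    (h0 : ∀ᶠ m in atTop, y m 0 ≠ 0 ∧ Real.log ‖y m 0‖ ≤ -T₀ m)
    (h1 : ∀ ε : ℝ, 0 < ε → ∀ᶠ m in atTop, y m 1 ≠ 0 ∧ |Real.log ‖y m 1‖ + T₁ m| ≤ ε * T₁ m)
    (h2 : Tendsto (fun m => ‖y m 2‖) atTop atTop)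
    (h2' : ∀ ε : ℝ, 0 < ε → ∀ᶠ m in atTop, Real.log ‖y m 2‖ ≤ ε * T₁ m) :
    ∀ᶠ m in atTop, eval (y m) H ≠ 0 := by
  classical
  set S := H.support with hS
  have hSne : S.Nonempty := Finset.nonempty_iff_ne_empty.2 fun h => hH (support_eq_empty.1 h)
  -- the lexicographic top class: least `d 0`, then least `d 1`
  obtain ⟨da, hda, hamin⟩ := S.exists_min_image (fun d : Fin 3 →₀ ℕ => d 0) hSne
  set S₁ := S.filter (fun d => d 0 = da 0) with hS₁
  have hS₁ne : S₁.Nonempty := ⟨da, Finset.mem_filter.2 ⟨hda, rfl⟩⟩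
  obtain ⟨ds, hds₁, hbmin⟩ := S₁.exists_min_image (fun d : Fin 3 →₀ ℕ => d 1) hS₁ne
  have hds : ds ∈ S := (Finset.mem_filter.1 hds₁).1
  have hds0 : ds 0 = da 0 := (Finset.mem_filter.1 hds₁).2
  set P := S.filter (fun d => d 0 = ds 0 ∧ d 1 = ds 1) with hP
  set Q := S.filter (fun d => ¬ (d 0 = ds 0 ∧ d 1 = ds 1)) with hQ
  have hPeq : ∀ d ∈ P, d 0 = ds 0 ∧ d 1 = ds 1 := fun d hd => (Finset.mem_filter.1 hd).2
  have hQcases : ∀ d ∈ Q, ds 0 + 1 ≤ d 0 ∨ (d 0 = ds 0 ∧ ds 1 + 1 ≤ d 1) := by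
    intro d hd
    obtain ⟨hdS, hne⟩ := Finset.mem_filter.1 hd
    have h0le : ds 0 ≤ d 0 := by rw [hds0]; exact hamin d hdS
    by_cases h0 : d 0 = ds 0
    · right
      refine ⟨h0, ?_⟩
      have h1le : ds 1 ≤ d 1 := hbmin d (Finset.mem_filter.2 ⟨hdS, by rw [h0, hds0]⟩)
      have h1ne : d 1 ≠ ds 1 := fun h1 => hne ⟨h0, h1⟩
      omega
    · left
      omega
  -- the univariate polynomial carried by the top class
  set G : Polynomial ℂ := ∑ d ∈ P, Polynomial.C (coeff d H) * Polynomial.X ^ (d 2) with hG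
  have hGne : G ≠ 0 := by
    intro hG0
    have hcoef : G.coeff (ds 2) = coeff ds H := by
      rw [hG, Polynomial.finsetSum_coeff, Finset.sum_eq_single ds]
      · simp
      · intro d hd hne
        have hd' := hPeq d hd
        have h2 : d 2 ≠ ds 2 := by
          intro h2
          apply hne
          ext i
          fin_cases i
          · exact hd'.1
          · exact hd'.2
          · exact h2
        simp [Polynomial.coeff_X_pow, Ne.symm h2]
      · intro hds'
        exact absurd (Finset.mem_filter.2 ⟨hds, rfl, rfl⟩) hds'
    rw [hG0, Polynomial.coeff_zero] at hcoef
    exact (mem_support_iff.1 hds) hcoef.symm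
  obtain ⟨c, hcpos, hGlow⟩ := exists_eventually_norm_eval_ge G hGne (z := fun m => y m 2) h2
  -- degree data and the tolerance `ε`
  set B : ℕ := S.sup (fun d => d 1) with hB
  set D : ℕ := S.sup (fun d => d 2) with hD
  have hBd : ∀ d ∈ S, d 1 ≤ B := fun d hd => Finset.le_sup (f := fun d : Fin 3 →₀ ℕ => d 1) hd
  have hDd : ∀ d ∈ S, d 2 ≤ D := fun d hd => Finset.le_sup (f := fun d : Fin 3 →₀ ℕ => d 2) hd
  set ε : ℝ := 1 / (4 * ((B : ℝ) + D + 1)) with hε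
  have hεpos : 0 < ε := by positivity
  have hεK : ε * (4 * ((B : ℝ) + D + 1)) = 1 := by
    rw [hε]; field_simp
  have hε1 : ε ≤ 1 := by
    rw [hε, div_le_one (by positivity)]; linarith [show (0 : ℝ) ≤ B by positivity, show (0 : ℝ) ≤ D by positivity]
  have hεD : (1 + (D : ℝ)) * ε ≤ 1 / 2 := by
    rw [hε]
    rw [show (1 + (D : ℝ)) * (1 / (4 * ((B : ℝ) + D + 1))) = (1 + (D : ℝ)) / (4 * ((B : ℝ) + D + 1)) by ring,
      div_le_iff₀ (by positivity)]
    linarith [show (0 : ℝ) ≤ B by positivity]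
  set Cs : ℝ := ∑ d ∈ Q, ‖coeff d H‖ with hCs
  -- the decisive decay `Cs e^{-T₁/2} < c` eventually
  have hdecay : ∀ᶠ m in atTop, Cs * Real.exp (-(1 / 2) * T₁ m) < c := by
    have h1 : Tendsto (fun m => Cs * Real.exp (-(1 / 2) * T₁ m)) atTop (𝓝 (Cs * 0)) :=
      (Real.tendsto_exp_atBot.comp (hT₁.const_mul_atTop_of_neg (by norm_num))).const_mul Cs
    rw [mul_zero] at h1
    exact h1.eventually (gt_mem_nhds hcpos)
  filter_upwards [h0, h1 ε hεpos, h2' ε hεpos, hGlow, hdecay, hT ε hεpos, hT₁.eventually_ge_atTop 0,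
    h2.eventually_ge_atTop 1] with m hm0 hm1 hm2 hmG hmdec hmT hT1 hy2
  obtain ⟨hy0, hl0⟩ := hm0
  obtain ⟨hy1, hl1⟩ := hm1
  have hy2' : y m 2 ≠ 0 := by
    intro h; rw [h, norm_zero] at hy2; linarith
  have hn0 : 0 < ‖y m 0‖ := norm_pos_iff.2 hy0
  have hn1 : 0 < ‖y m 1‖ := norm_pos_iff.2 hy1
  -- `T₀ ≥ 4(B+D+1) T₁ ≥ 0`
  have hT0 : 4 * ((B : ℝ) + D + 1) * T₁ m ≤ T₀ m := by
    have := mul_le_mul_of_nonneg_left hmT (show (0 : ℝ) ≤ 4 * ((B : ℝ) + D + 1) by positivity)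
    calc 4 * ((B : ℝ) + D + 1) * T₁ m ≤ 4 * ((B : ℝ) + D + 1) * (ε * T₀ m) := this
      _ = T₀ m := by rw [← mul_assoc, mul_comm (4 * _) ε, hεK, one_mul]
  -- sizes of the coordinates
  have hny0 : ‖y m 0‖ ≤ Real.exp (-T₀ m) := by
    rw [← Real.exp_log hn0]; exact Real.exp_le_exp.2 hl0
  have hBDT : 0 ≤ 4 * ((B : ℝ) + D + 1) * T₁ m := by positivity
  have hεT : ε * T₁ m ≤ T₁ m := mul_le_of_le_one_left hT1 hε1
  have hny0' : ‖y m 0‖ ≤ 1 := hny0.trans (by rw [Real.exp_le_one_iff]; linarith)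
  have hny1 : ‖y m 1‖ ≤ Real.exp (-T₁ m + ε * T₁ m) := by
    rw [← Real.exp_log hn1]; exact Real.exp_le_exp.2 (by linarith [(abs_le.1 hl1).2])
  have hny1' : ‖y m 1‖ ≤ 1 := hny1.trans (by rw [Real.exp_le_one_iff]; linarith)
  have hny1lo : Real.exp (-T₁ m - ε * T₁ m) ≤ ‖y m 1‖ := by
    rw [← Real.exp_log hn1]; exact Real.exp_le_exp.2 (by linarith [(abs_le.1 hl1).1])
  have hny2 : ‖y m 2‖ ^ D ≤ Real.exp ((D : ℝ) * (ε * T₁ m)) := by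
    rw [Real.exp_nat_mul]
    exact pow_le_pow_left₀ (norm_nonneg _) (by
      calc ‖y m 2‖ = Real.exp (Real.log ‖y m 2‖) := (Real.exp_log (by linarith)).symm
        _ ≤ Real.exp (ε * T₁ m) := Real.exp_le_exp.2 hm2) _
  have hy2pow : ∀ d ∈ S, ‖y m 2‖ ^ d 2 ≤ Real.exp ((D : ℝ) * (ε * T₁ m)) := fun d hd =>
    (pow_le_pow_right₀ hy2 (hDd d hd)).trans hny2
  -- every non-top monomial is smaller than the top size by `e^{-T₁/2}`
  have hterm : ∀ d ∈ Q, ‖coeff d H * ∏ i, y m i ^ d i‖ ≤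
      ‖coeff d H‖ * (‖y m 0‖ ^ ds 0 * ‖y m 1‖ ^ ds 1 * Real.exp (-(1 / 2) * T₁ m)) := by
    intro d hd
    have hdS : d ∈ S := (Finset.mem_filter.1 hd).1
    rw [norm_mul, norm_prod, Fin.prod_univ_three, norm_pow, norm_pow, norm_pow]
    refine mul_le_mul_of_nonneg_left ?_ (norm_nonneg _)
    have hlo1 : Real.exp (-((ds 1 : ℕ) : ℝ) * (T₁ m + ε * T₁ m)) ≤ ‖y m 1‖ ^ ds 1 := by
      rw [show -((ds 1 : ℕ) : ℝ) * (T₁ m + ε * T₁ m) = ((ds 1 : ℕ) : ℝ) * (-T₁ m - ε * T₁ m) by ring,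
        Real.exp_nat_mul]
      exact pow_le_pow_left₀ (Real.exp_pos _).le hny1lo _
    have hds1B : ((ds 1 : ℕ) : ℝ) ≤ B := by exact_mod_cast hBd ds hds
    rcases hQcases d hd with h | ⟨h0eq, h1⟩
    · -- more `y₀`: lose `e^{-T₀}`
      have hp0 : ‖y m 0‖ ^ d 0 ≤ ‖y m 0‖ ^ ds 0 * Real.exp (-T₀ m) := by
        rw [show d 0 = ds 0 + (d 0 - ds 0) by omega, pow_add]
        refine mul_le_mul_of_nonneg_left ?_ (by positivity)
        calc ‖y m 0‖ ^ (d 0 - ds 0) ≤ ‖y m 0‖ ^ 1 := pow_le_pow_of_le_one hn0.le hny0' (by omega)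
          _ ≤ Real.exp (-T₀ m) := by rw [pow_one]; exact hny0
      have hp1 : ‖y m 1‖ ^ d 1 ≤ 1 := pow_le_one₀ (norm_nonneg _) hny1'
      calc ‖y m 0‖ ^ d 0 * ‖y m 1‖ ^ d 1 * ‖y m 2‖ ^ d 2
          ≤ (‖y m 0‖ ^ ds 0 * Real.exp (-T₀ m)) * 1 * Real.exp ((D : ℝ) * (ε * T₁ m)) :=
            mul_le_mul (mul_le_mul hp0 hp1 (by positivity) (by positivity)) (hy2pow d hdS)
              (by positivity) (by positivity)
        _ = ‖y m 0‖ ^ ds 0 * Real.exp (-T₀ m + (D : ℝ) * (ε * T₁ m)) := by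
            simp only [Real.exp_add]; ring
        _ ≤ ‖y m 0‖ ^ ds 0 * (Real.exp (-((ds 1 : ℕ) : ℝ) * (T₁ m + ε * T₁ m)) *
              Real.exp (-(1 / 2) * T₁ m)) := by
            refine mul_le_mul_of_nonneg_left ?_ (by positivity)
            rw [← Real.exp_add]
            refine Real.exp_le_exp.2 ?_
            have h1 : (D : ℝ) * (ε * T₁ m) ≤ (D : ℝ) * T₁ m := by
              have : ε * T₁ m ≤ 1 * T₁ m := mul_le_mul_of_nonneg_right hε1 hT1
              rw [one_mul] at this
              exact mul_le_mul_of_nonneg_left this (by positivity)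
            have h2 : ((ds 1 : ℕ) : ℝ) * (T₁ m + ε * T₁ m) ≤ (B : ℝ) * (2 * T₁ m) := by
              refine mul_le_mul hds1B (by linarith) (by positivity) (by positivity)
            have hBT : 0 ≤ (B : ℝ) * T₁ m := by positivity
            have hDT : 0 ≤ (D : ℝ) * T₁ m := by positivity
            linarith
        _ ≤ ‖y m 0‖ ^ ds 0 * (‖y m 1‖ ^ ds 1 * Real.exp (-(1 / 2) * T₁ m)) := by
            gcongr
        _ = _ := by ring
    · -- same `y₀`, more `y₁`: lose `e^{-T₁/2}`
      have hp1 : ‖y m 1‖ ^ d 1 ≤ ‖y m 1‖ ^ ds 1 * Real.exp (-T₁ m + ε * T₁ m) := by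
        rw [show d 1 = ds 1 + (d 1 - ds 1) by omega, pow_add]
        refine mul_le_mul_of_nonneg_left ?_ (by positivity)
        calc ‖y m 1‖ ^ (d 1 - ds 1) ≤ ‖y m 1‖ ^ 1 := pow_le_pow_of_le_one hn1.le hny1' (by omega)
          _ ≤ Real.exp (-T₁ m + ε * T₁ m) := by rw [pow_one]; exact hny1
      rw [h0eq]
      calc ‖y m 0‖ ^ ds 0 * ‖y m 1‖ ^ d 1 * ‖y m 2‖ ^ d 2
          ≤ ‖y m 0‖ ^ ds 0 * (‖y m 1‖ ^ ds 1 * Real.exp (-T₁ m + ε * T₁ m)) *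
              Real.exp ((D : ℝ) * (ε * T₁ m)) :=
            mul_le_mul (mul_le_mul_of_nonneg_left hp1 (by positivity)) (hy2pow d hdS)
              (by positivity) (by positivity)
        _ = ‖y m 0‖ ^ ds 0 * ‖y m 1‖ ^ ds 1 * Real.exp (-T₁ m + ε * T₁ m + (D : ℝ) * (ε * T₁ m)) := by
            simp only [Real.exp_add]; ring
        _ ≤ ‖y m 0‖ ^ ds 0 * ‖y m 1‖ ^ ds 1 * Real.exp (-(1 / 2) * T₁ m) := by
            have hexp : -T₁ m + ε * T₁ m + (D : ℝ) * (ε * T₁ m) ≤ -(1 / 2) * T₁ m := by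
              have := mul_le_mul_of_nonneg_right hεD hT1
              linarith
            gcongr
  -- upper bound for the rest
  have hrest : ∑ d ∈ Q, ‖coeff d H * ∏ i, y m i ^ d i‖ ≤
      Cs * (‖y m 0‖ ^ ds 0 * ‖y m 1‖ ^ ds 1 * Real.exp (-(1 / 2) * T₁ m)) := by
    rw [hCs, Finset.sum_mul]
    exact Finset.sum_le_sum hterm
  -- split the evaluation
  rw [MvPolynomial.eval_eq', ← Finset.sum_filter_add_sum_filter_not S (fun d => d 0 = ds 0 ∧ d 1 = ds 1)]
  have hmain : ∑ d ∈ P, coeff d H * ∏ i, y m i ^ d i =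
      y m 0 ^ ds 0 * y m 1 ^ ds 1 * G.eval (y m 2) := by
    rw [hG, Polynomial.eval_finsetSum, Finset.mul_sum]
    refine Finset.sum_congr rfl fun d hd => ?_
    obtain ⟨hd0, hd1⟩ := hPeq d hd
    rw [Fin.prod_univ_three, hd0, hd1, Polynomial.eval_mul, Polynomial.eval_C, Polynomial.eval_pow,
      Polynomial.eval_X]
    ring
  rw [← hP, ← hQ, hmain]
  -- lower bound for the main term and comparison
  have hX : 0 < ‖y m 0‖ ^ ds 0 * ‖y m 1‖ ^ ds 1 := by positivity
  have hmain_lo : c * (‖y m 0‖ ^ ds 0 * ‖y m 1‖ ^ ds 1) ≤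
      ‖y m 0 ^ ds 0 * y m 1 ^ ds 1 * G.eval (y m 2)‖ := by
    rw [norm_mul, norm_mul, norm_pow, norm_pow, mul_comm c]
    exact mul_le_mul_of_nonneg_left hmG hX.le
  have hlt : ∑ d ∈ Q, ‖coeff d H * ∏ i, y m i ^ d i‖ <
      ‖y m 0 ^ ds 0 * y m 1 ^ ds 1 * G.eval (y m 2)‖ := by
    refine lt_of_le_of_lt hrest (lt_of_lt_of_le ?_ hmain_lo)
    rw [show Cs * (‖y m 0‖ ^ ds 0 * ‖y m 1‖ ^ ds 1 * Real.exp (-(1 / 2) * T₁ m)) =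
      Cs * Real.exp (-(1 / 2) * T₁ m) * (‖y m 0‖ ^ ds 0 * ‖y m 1‖ ^ ds 1) by ring]
    exact mul_lt_mul_of_pos_right hmdec hX
  intro hzero
  have hsum : y m 0 ^ ds 0 * y m 1 ^ ds 1 * G.eval (y m 2) =
      -(∑ d ∈ Q, coeff d H * ∏ i, y m i ^ d i) := eq_neg_of_add_eq_zero_left hzero
  have : ‖y m 0 ^ ds 0 * y m 1 ^ ds 1 * G.eval (y m 2)‖ ≤
      ∑ d ∈ Q, ‖coeff d H * ∏ i, y m i ^ d i‖ := by
    rw [hsum, norm_neg]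
    exact norm_sum_le _ _
  linarith

end LexScale

/-! ## Density form -/

section Density

variable {n : ℕ}

/-- **THEOREM I‴, density form.**  `S` irreducible closed with `dim S ≤ 3`, three coordinates
`c₀, c₁, c₂`, and a sequence of exponential points of `S` whose `c₀`-coordinate decays at least
like `e^{−T₀}`, whose `c₁`-coordinate decays like `e^{−T₁(1+o(1))}` with `T₁ → ∞`, `T₁ = o(T₀)`,
and whose `c₂`-coordinate tends to infinity with `log = o(T₁)`: then `I(S ∩ Γ_exp) = I(S)`. (new) -/
theorem unprojectedDense_of_lexScale {S : Set (Fin n ⊕ Fin n → ℂ)} (hS : IsIrreducibleClosed ℂ S)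
    (hdim : zariskiDim ℂ S ≤ ((2 + 1 : ℕ) : WithBot ℕ∞)) (c : Fin 3 → Fin n ⊕ Fin n)
    {p : ℕ → Fin n ⊕ Fin n → ℂ} (hp : ∀ᶠ m in atTop, p m ∈ S ∧ p m ∈ expGraph ℂ n)
    {T₀ T₁ : ℕ → ℝ} (hT₁ : Tendsto T₁ atTop atTop)
    (hT : ∀ ε : ℝ, 0 < ε → ∀ᶠ m in atTop, T₁ m ≤ ε * T₀ m)
    (h0 : ∀ᶠ m in atTop, p m (c 0) ≠ 0 ∧ Real.log ‖p m (c 0)‖ ≤ -T₀ m)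
    (h1 : ∀ ε : ℝ, 0 < ε → ∀ᶠ m in atTop, p m (c 1) ≠ 0 ∧ |Real.log ‖p m (c 1)‖ + T₁ m| ≤ ε * T₁ m)
    (h2 : Tendsto (fun m => ‖p m (c 2)‖) atTop atTop)
    (h2' : ∀ ε : ℝ, 0 < ε → ∀ᶠ m in atTop, Real.log ‖p m (c 2)‖ ≤ ε * T₁ m) :
    UnprojectedDense S := by
  refine unprojectedDense_of_no_relation hS hdim c fun H hH => ?_
  have hev := eventually_eval_ne_zero_of_lexScale H hH (y := fun m i => p m (c i)) hT₁ hT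
    h0 h1 h2 h2'
  obtain ⟨m, hmS, hne⟩ := (hp.and hev).exists
  exact ⟨p m, hmS, hne⟩

end Density

end Summit.Schanuel.Schanuel.Theorems
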